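import Summits.ABC.IUTFork.Conditional.Layer5OfSV13
import Literature.IUT.HodgeTheaters.GoodLocalFrobenioidOfGaloisDdash
import Literature.IUT.HodgeTheaters.GoodLocalFrobenioidOfPlaceSlim
import Literature.IUT.HodgeTheaters.InitialThetaDataLocalSlim
import Literature.IUT.HodgeTheaters.GoodLocalFrobenioidOfKitSplitTransport
import HarnessLib

/-!
# Layer-5 certificate, ADDITIVE PART v0.14 — [IUTchI] §3: NEW COVERAGE — the held row Ex 3.3 (iii), all five clauses (a)–(e), at the PRINTED good-place
# Frobenioid of the initial Θ-datum, by the sub-DAG closers BY NAME (SUBDAG-IUTchI-Ex33-Ex34 rows E33iii/a–e; abc-iut-w4-d047, abc-iut-w5-d096, abc-iut-L1-t4,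
# abc-iut-L5-t16, abc-iut-L5-t2 lineages) (director-abc (C2); plan/L5/LAYER5-CERT-SPEC.md §7; abc-iut-L5-lead gen 6 RULINGS #80, #83, #84 (3); writer abc-iut-L5-d1 gen 7)

cert L5 v0.14 additive part (one module, PROOF-ONLY: no `def`, no `instance`, no `axiom`, no `sorry`, no `notation`; every input BY NAME; nothing of
v0–v0.13 is touched).  ONE theorem, then the top `layer5_of_S_v14`:

* (X) `layer5_held_ex33iii_v14_printedObject` — the held row IUTchI:Ex3.3(iii) («after-merge schema», NOT conjoined in v0–v0.13: v0 header) at the PRINTED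
  object: for the REAL initial Θ-datum `D` (abc-iut-L5-t2) at `v̲ ∈ V̲^good ∩ V̲^non` with `K_v̲ = k` (complete, finite over `ℚ_p`, `K ⊂ k` dense) along
  `ι : F̄ → k̄`, abc-iut-L5-t2's `InitialThetaData.goodLocalFrobenioidOfEmb p k ι hX` ([IUTchI] Ex 3.3 (i)–(ii) = the [FrdII] Ex 1.1 Frobenioid over
  `𝓑(Π_v̲)⁰`, `Π_v̲ := Π_{X̲→_K} ×_{G_K} Gal(k̄/k)`) satisfies the five typed reconstruction clauses of Ex 3.3 (iii) p.79 — (a) `DdashFromD` · (b) `BasesFromC` ·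
  (c) `DFromF` · (d) `CdashFromF` · (e) `SplitFromF` — by the closers `ddashFromD_goodLocalFrobenioidOfEmb_of_forall_map_ker` (a; abc-iut-w4-d047,
  GoodLocalFrobenioidOfGaloisDdash) · `basesFromC_goodLocalFrobenioidOfEmb` (b; abc-iut-w5-d096, GoodLocalFrobenioidOfPlaceSlim p419963) ·
  `dFromF_goodLocalFrobenioidOfEmb_of_geom_slim` (c; abc-iut-w5-d096, InitialThetaDataLocalSlim p420763) · `cdashFromF_goodLocalFrobenioidOfEmb` (d;
  GoodLocalFrobenioidOfGaloisBaseRam, abc-iut-w4-d047 / abc-iut-L1-t4 / abc-iut-L5-t16 lineage: [FrdI] Cor 4.11 (iii) + [AbsAnab] Prop 1.2.1 (v) PROVED) ·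
  `splitFromF_goodLocalFrobenioidOfEmb_of_isPreservedBy` (e; abc-iut-w4-d047, GoodLocalFrobenioidOfKitSplitTransport p458795: (e) ⟸ (d) + `hfix`).
  BINDERS: DATA `D p k ι`; SIDE `hd` (density — a theorem at every completion `K_w`); LAW `hX` (Def 3.1 (f) openness) · `hΔ` (FACT-LIST F-0007 `PreservesGeom`,
  [AbsAnab] Lem 1.3.8, in its UNFOLDED local shape at `v̲`) · `hfix` ([AbsTopIII] Prop 3.2 (iii) content: every self-equivalence of `𝒞_v̲` preserves
  `τ_{p_v̲}` — abc-iut-L5-t16 g7 row «E33iii/e hfix-genuine» in flight; FALSE at the degenerate `ofKitQp`, `not_splitFromF_ofKitQp`) = LAW 3; FACT BY NAME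
  `hF_0240 : D.geom.extF.GeomTFG` (F-0240, [AbsTopI] Prop 2.2 — Galois-countability of `Π_{C_F}` via abc-iut-L5-t6 `secondCountableTopology_PiC_of_geomTFG`) ·
  `hF_0004 : GeomAndArithSlim D.geom.extF` (F-0004, [AbsAnab] Lem 1.3.1; first conjunct `Δ_C slim` used) = FACT 2 (both FACT-LIST rows «admissible AT NAMED
  INSTANCES ONLY»; consumed BY NAME, never discharged under M).  Token IUTchI:Ex3.3(iii) stays HELD:after-merge.

CENSUS v0.14 (abc-iut-L5-lead gen 6 BOOKING in the countersign line 18:16:38Z — same rule as the v0.9 §6 booking, RULINGS #69: the headline counts EVERY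
conjunct of the top): headline most-reduced **CONE 38 (= 35 + LAW 3 of (X); +2 record-laws in `P`, +1 in `M'`) · FACT 2 (F-0240, F-0004 BY NAME — the FIRST
FACT binders in the certificate, flagged as such) · side 17 · NV 3**; COVERAGE += row IUTchI:Ex3.3(iii) (a)–(e) at the printed object; bracket line: «of which
(X): LAW 3 · FACT 2 · side 1; the §2–§6 block is UNCHANGED at 35 · 0 · 16».  THE COUNT WENT UP BECAUSE COVERAGE WENT UP (a held row that had no conjunct now has
one); no token moves (Ex3.3(iii) stays HELD:after-merge: `hΔ`/`hfix` are the [AbsAnab]/[AbsTopIII] sockets).  NV of (X)'s binder set: `hd`/`hX`-free degenerate tightness witnesses exist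
for (d)/(e) at `ofKitQp` (abc-iut-w4-d047: `not_splitFromF_ofKitQp`), i.e. `hfix` is a genuine hypothesis; no joint witness of {D, hX, hF_0240, hF_0004,
hΔ, hfix} in tree — none claimed.  RULINGS #71 (4)/#84 (3) respected: NO `Nonempty`-at-a-model conjunct, NO `EvalBinder`/`KitCore`-bound conjunct.  §2
honesty note of v0.13 (GAP G-f193g4-1) unchanged.  NV/tightness column update (RULINGS #85 (1)): v0.5's `layer5_held_ex51i_L07`/E51 L11 binder
`BaseCatRigid`-type law of `layer5_held_ex51i_L11` (v0.1) — NV-L5 #55 abc-iut-w5-d110 p457057 (degenerate witness) · TIGHT p459003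
`GlobalFrobenioidsBaseCatRigidTightness` (¬BaseCatRigid(ℤ/3) via the inversion twist: the binder is not a tautology).  S-FREE.  Post-freeze-additive modules imported for the closers (not cone members, all proof-only):
GoodLocalFrobenioidOfGaloisDdash, GoodLocalFrobenioidOfPlaceSlim (p419963), InitialThetaDataLocalSlim (p420763), GoodLocalFrobenioidOfKitSplitTransport (p458795)
— over abc-iut-L5-t2's InitialThetaDataGoodLocalFrobenioid (def-bearing: `goodLocalFrobenioidOfEmb` used as a TERM) and the L1 [FrdII] kit files.

Mochizuki, *Inter-universal Teichmüller theory I: construction of Hodge theaters*, kurims manuscript (May 2020) [cite: Mochizuki2012]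
(D-0012 claim key; series status DISPUTED; pages = kurims preprint render IUTchI-kurims-url-690e7b3c6199); Mochizuki, *The geometry of Frobenioids II*,
Kyushu J. Math. 62 (2008) [cite: MochizukiFrdII2008, Ex 1.1 p.8].  HONEST FRAMING: nothing in this file asserts that abc is proved or refuted or takes a side
on [IUTchIII] Cor. 3.12 (nor on [IUTchI], [AbsAnab], [AbsTopI], [AbsTopIII] in print); every binder is an ASSUMPTION LABEL; a FACT binder is a frozen
FACT-LIST row consumed BY NAME; typed ≠ inhabited ≠ discharged; indexed ≠ endorsed; establishment = OUR kernel check only.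
-/

namespace Summit.ABC.IUTFork.Conditional

open CategoryTheory Literature.IUT.HodgeTheaters
universe u v w

noncomputable section Ex33iiiEmbV14

open Literature.AnabelianGeometry.SemiGraphs Literature.AlgebraicGeometry.Frobenioids Literature.AlgebraicGeometry.Frobenioids.PadicFrd
open Literature.AnabelianGeometry.AbsoluteAnabelian

/-! ## Ex 3.3 (iii) (NEW COVERAGE): the held row IUTchI:Ex3.3(iii), ALL FIVE clauses (a)–(e), at the PRINTED object `goodLocalFrobenioidOfEmb` of the initial Θ-datum (`K_v̲ = k` complete over `ℚ_p`, `K ⊂ k` dense, along `ι : F̄ → k̄`) — sub-DAG SUBDAG-IUTchI-Ex33-Ex34 rows E33iii/a–e BY NAME -/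

/-- **Ex 3.3 (iii) (a)(b)(c)(d)(e) AT THE PRINTED OBJECT** — a held row not conjoined in v0–v0.13 («after-merge schema», v0 header): for the REAL initial
Θ-datum `D` (abc-iut-L5-t2) at `v̲ ∈ V̲^good ∩ V̲^non` with `K_v̲ = k` (any complete nonarchimedean field finite over `ℚ_p` into which `K` embeds DENSELY, `hd`)
along a `K`-embedding `ι : F̄ → k̄` — abc-iut-L5-t2's object `InitialThetaData.goodLocalFrobenioidOfEmb p k ι hX` ([IUTchI] Ex 3.3 (i)–(ii): the [FrdII]
Ex 1.1 Frobenioid over `𝓑(Π_v̲)⁰`, `Π_v̲ := Π_{X̲→_K} ×_{G_K} Gal(k̄/k)`) — the five reconstruction clauses of Ex 3.3 (iii) p.79 as typed by abc-iut-L5-t2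
(`GoodLocalFrobenioid.DdashFromD` (a) · `BasesFromC` (b) · `DFromF` (c) · `CdashFromF` (d) · `SplitFromF` (e)) HOLD, by the sub-DAG closers BY NAME:
(a) abc-iut-w4-d047 `ddashFromD_goodLocalFrobenioidOfEmb_of_forall_map_ker` ([AbsAnab] Lem 1.3.8 in the shape `hΔ`; Galois-countability of `Π_{C_F}` from
F-0240 via abc-iut-L5-t6 `secondCountableTopology_PiC_of_geomTFG`) · (b) abc-iut-w5-d096 `basesFromC_goodLocalFrobenioidOfEmb` (p419963; UNCONDITIONAL: [FrdI]
Thm 3.4 (v), [FrdII] Thm 1.2 (i), [AbsAnab] Thm 1.1.1 (ii) are tree theorems) · (c) abc-iut-w5-d096 `dFromF_goodLocalFrobenioidOfEmb_of_geom_slim` (p420763; `Δ_C`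
slim = F-0004's first conjunct) · (d) abc-iut-w4-d047 / abc-iut-L1-t4 / abc-iut-L5-t16 lineage `cdashFromF_goodLocalFrobenioidOfEmb` (GoodLocalFrobenioidOfGaloisBaseRam:
[FrdI] Cor 4.11 (iii) + [AbsAnab] Prop 1.2.1 (v) PROVED, ramification clause discharged via `PadicFld.exists_ordInt_mulEquiv_of_normLike` p447104 …) · (e)
abc-iut-w4-d047 `splitFromF_goodLocalFrobenioidOfEmb_of_isPreservedBy` (GoodLocalFrobenioidOfKitSplitTransport p458795: (e) ⟸ (d) + `hfix`, the structural
inputs on `τ_{p_v̲}` discharged over the [FrdII] kit).  BINDERS, exhaustively: DATA `D` (+ instances `IsScalarTower F K Fbar`, `Normal K Fbar`; `K`, `F̄` in `Type` as in the sub-DAG's Galois-countability lemma), the prime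
`p`, the field `k` (+ its instances), the embedding `ι`; SIDE `hd : DenseRange (K → k)` (true at every completion `K_w`, `HeightOneSpectrum.denseRange_algebraMap`);
LAW `hX` (Def 3.1 (f): `Π_{X̲→_K}` OPEN in `Π_{C_K}` — the datum's printed openness input, as for the object itself); FACT BY NAME `hF_0240 :
D.geom.extF.GeomTFG` (FACT-LIST F-0240, [AbsTopI] Prop 2.2; AT NAMED INSTANCES ONLY) and `hF_0004 : GeomAndArithSlim D.geom.extF` (F-0004, [AbsAnab] Lem 1.3.1;
first conjunct used; AT NAMED INSTANCES ONLY); LAW `hΔ` = F-0007 `PreservesGeom` ([AbsAnab] Lem 1.3.8) in its UNFOLDED local shape at `v̲` (by-name form =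
socket E33iii/a `ddashFromD_goodLocalFrobenioidOfEmb_of_preservesGeom`); LAW `hfix` = «every self-equivalence of the REAL `𝒞_v̲` preserves the
characteristic splitting `τ_{p_v̲}`» ([AbsTopIII] Prop 3.2 (iii) content = sockets (E1) [FrdI] Thm 3.4 (iv) / (E2) geometricity / (E3) classical unit
rigidity `EquivariantUnitRigidity` abc-iut-w4-d014 p457975; abc-iut-L5-t16 g7 row «E33iii/e hfix-genuine» in flight; FALSE at the degenerate `ofKitQp`,
`not_splitFromF_ofKitQp` — a genuine hypothesis).  Census (abc-iut-L5-lead's booking): NEW COVERAGE conjunct, LAW 3 (`hX`, `hΔ`, `hfix`) + FACT 2 BY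
NAME (F-0240, F-0004) + SIDE 1 (`hd`); token IUTchI:Ex3.3(iii) stays HELD:after-merge.  Nothing here asserts that abc is proved or refuted or takes a side
on [IUTchIII] Cor. 3.12 (nor on [AbsAnab]/[AbsTopI]/[AbsTopIII] in print); a binder is an assumption label; typed ≠ discharged. ([IUTchI] Ex 3.3 (iii) p.79) -/
theorem layer5_held_ex33iii_v14_printedObject
    {F : Type u} {K : Type} {Fbar : Type} [Field F] [NumberField F] [Field K] [NumberField K]
    [Algebra F K] [Field Fbar] [Algebra F Fbar] [Algebra K Fbar] [IsScalarTower F K Fbar] [Normal K Fbar]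
    {E : WeierstrassCurve F} [E.IsElliptic] {l : ℕ} {Pb : BadPlacePredicates K}
    (D : InitialThetaData F K Fbar E l Pb) (p : ℕ) [Fact p.Prime]
    -- `K_v̲ = k`: a complete nonarchimedean field, finite over `ℚ_p`, with `K ⊂ k` dense, and a `K`-embedding `ι : F̄ → k̄`
    (k : Type) [NontriviallyNormedField k] [CompleteSpace k] [IsUltrametricDist k] [NormedAlgebra ℚ_[p] k]
    [FiniteDimensional ℚ_[p] k] [Algebra K k] (ι : Fbar →ₐ[K] AlgebraicClosure k) (hd : DenseRange (algebraMap K k))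
    -- LAW (Def 3.1 (f)): `Π_{X̲→_K}` open in `Π_{C_K}`
    (hX : IsOpen (D.PiXarrow : Set D.PiC))
    -- FACTS BY NAME: F-0240 `GeomTFG` ([AbsTopI] Prop 2.2), F-0004 `GeomAndArithSlim` ([AbsAnab] Lem 1.3.1)
    (hF_0240 : D.geom.extF.GeomTFG) (hF_0004 : FundamentalExtension.GeomAndArithSlim D.geom.extF)
    -- LAW = F-0007 `PreservesGeom` ([AbsAnab] Lem 1.3.8) in its unfolded local shape at `v̲`
    (hΔ : ∀ φ : D.PiLoc D.PiXarrow (localToGF F k ι) ≃ₜ* D.PiLoc D.PiXarrow (localToGF F k ι),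
      (D.augLoc D.PiXarrow (localToGF F k ι)).ker.map φ.toMulEquiv.toMonoidHom =
        (D.augLoc D.PiXarrow (localToGF F k ι)).ker)
    -- LAW = [AbsTopIII] Prop 3.2 (iii) content: every self-equivalence of `𝒞_v̲` preserves `τ_{p_v̲}` (abc-iut-L5-t16 «E33iii/e hfix-genuine»)
    (hfix : ∀ e : @GoodLocalFrobenioid.Cv p k _ (GaloisValDatum.normVal k) (D.goodLocalFrobenioidOfEmb p k ι hX) ≌
        @GoodLocalFrobenioid.Cv p k _ (GaloisValDatum.normVal k) (D.goodLocalFrobenioidOfEmb p k ι hX),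
      S3Local.CharSplitting.IsPreservedBy
        ⟨(Datum.perf (CosetCat.push (D.augLoc D.PiXarrow (localToGF F k ι))
              (D.isOpenMap_augLoc D.PiXarrow (localToGF F k ι) hX (continuous_localToGF F k ι)) ⋙
              (GaloisValDatum.ofComplete p k).fieldFunctor)
            (GoodLocalFrobenioid.hlocOver (CosetCat.push (D.augLoc D.PiXarrow (localToGF F k ι))
              (D.isOpenMap_augLoc D.PiXarrow (localToGF F k ι) hX (continuous_localToGF F k ι)))
              (GaloisValDatum.ofComplete p k).fieldFunctor (GaloisValDatum.ofComplete p k).fieldFunctor_isPadicLocal)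
            CosetCat.isConnected CosetCat.isTotallyEpimorphic).pSplittingSubmonoid⟩
        ⟨(Datum.perf (CosetCat.push (D.augLoc D.PiXarrow (localToGF F k ι))
              (D.isOpenMap_augLoc D.PiXarrow (localToGF F k ι) hX (continuous_localToGF F k ι)) ⋙
              (GaloisValDatum.ofComplete p k).fieldFunctor)
            (GoodLocalFrobenioid.hlocOver (CosetCat.push (D.augLoc D.PiXarrow (localToGF F k ι))
              (D.isOpenMap_augLoc D.PiXarrow (localToGF F k ι) hX (continuous_localToGF F k ι)))
              (GaloisValDatum.ofComplete p k).fieldFunctor (GaloisValDatum.ofComplete p k).fieldFunctor_isPadicLocal)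
            CosetCat.isConnected CosetCat.isTotallyEpimorphic).pSplittingSubmonoid⟩ e.functor) :
    @GoodLocalFrobenioid.DdashFromD p k _ (GaloisValDatum.normVal k) (D.goodLocalFrobenioidOfEmb p k ι hX) ∧  -- IUTchI:Ex3.3(iii) (a)
      @GoodLocalFrobenioid.BasesFromC p k _ (GaloisValDatum.normVal k) (D.goodLocalFrobenioidOfEmb p k ι hX) ∧  -- IUTchI:Ex3.3(iii) (b)
      @GoodLocalFrobenioid.DFromF p k _ (GaloisValDatum.normVal k) (D.goodLocalFrobenioidOfEmb p k ι hX) ∧  -- IUTchI:Ex3.3(iii) (c)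
      @GoodLocalFrobenioid.CdashFromF p k _ (GaloisValDatum.normVal k) (D.goodLocalFrobenioidOfEmb p k ι hX) ∧  -- IUTchI:Ex3.3(iii) (d)
      @GoodLocalFrobenioid.SplitFromF p k _ (GaloisValDatum.normVal k) (D.goodLocalFrobenioidOfEmb p k ι hX) :=  -- IUTchI:Ex3.3(iii) (e)
  haveI := D.secondCountableTopology_PiC_of_geomTFG hF_0240
  ⟨D.ddashFromD_goodLocalFrobenioidOfEmb_of_forall_map_ker p k ι hX hd hΔ, D.basesFromC_goodLocalFrobenioidOfEmb p k ι hX,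
    D.dFromF_goodLocalFrobenioidOfEmb_of_geom_slim p k hF_0004.1 ι hX, D.cdashFromF_goodLocalFrobenioidOfEmb p k ι hX hd hF_0004.1 hΔ,
    D.splitFromF_goodLocalFrobenioidOfEmb_of_isPreservedBy p k ι hX hd hF_0004.1 hΔ hfix⟩

end Ex33iiiEmbV14

/-- **THE LAYER-5 CERTIFICATE v14 — SINGLE TOP OF RECORD**: the conjunction, BY NAME via `StatementOf`, of the v13 top `layer5_of_S_v13`
(`Conditional/Layer5OfSV13.lean`, p458154; through it v12 … v0 and the companion) and this module's `layer5_held_ex33iii_v14_printedObject` ((X), NEW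
COVERAGE: Ex 3.3 (iii) (a)–(e) at the printed object).  CENSUS v14 (abc-iut-L5-lead booking 18:16:38Z): headline most-reduced CONE 38 (= 35 + LAW 3 of (X)) · FACT 2
(F-0240, F-0004 BY NAME; first facts in the certificate) · side 17 · NV 3 — THE COUNT WENT UP BECAUSE COVERAGE WENT UP (bracket: (X) = LAW 3 · FACT 2 ·
side 1; the §2–§6 block unchanged at 35 · 0 · 16); no token moves.  S-FREE.  Nothing here asserts that abc is proved or refuted or takes a side on
[IUTchIII] Cor. 3.12; a binder is an assumption label; typed ≠ discharged; indexed ≠ endorsed. -/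
theorem layer5_of_S_v14 :
    Summit.ABC.IUTFork.DAG.PartL5a.StatementOf @layer5_of_S_v13 ∧
    Summit.ABC.IUTFork.DAG.PartL5a.StatementOf @layer5_held_ex33iii_v14_printedObject :=
  ⟨@layer5_of_S_v13, @layer5_held_ex33iii_v14_printedObject⟩

end Summit.ABC.IUTFork.Conditional

/-! ### Build-lane export guard (ops-buildfix bf1-g30, 2026-08-28; G11b-3 recipe v2 as in `GelbartRogawski1991/UnitaryDualPairSeesawCharacter`):
the theorems of this file carry very large dependent telescopes; at `.olean` export Lean 4.32's library-suggestion indexers fold over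
every local theorem statement and do not finish within the build lane's one-hour clock (measured on a farm node: `lean -o` > 1 500 s, plain
elaboration ≈ 20 s). ONE file-final `local` `[implicit_reducible]` keeps them out of that premise index (inert for Meta and the kernel on
theorems; no definition is tagged; statements and proofs unchanged). -/
set_option allowUnsafeReducibility true in
attribute [local implicit_reducible]
  _root_.Summit.ABC.IUTFork.Conditional.layer5_held_ex33iii_v14_printedObject
  _root_.Summit.ABC.IUTFork.Conditional.layer5_of_S_v14
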